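import Literature.MathematicalPhysics.QuantumManyBody.InsertionStateIdentities
import HarnessLib

/-!
# Crux `CorrectorClosure` (stmt-AtomisticToContinuum-12058), line `llp-fidelity-arc` —
registered stub `stub_insertionStateIdentities`

Supports (does not close) stmt-AtomisticToContinuum-12058, route `BECInsertionCorrector`.
The registered stub (c,d) of the lead's skeleton `Cruxes/CorrectorClosure/Lines/llp-fidelity-arc.lean`,
assembled from the Literature identities `coupledEnergy_zero_insertionState` and
`nnnorm_taggedInner_insertionState_sq` (`InsertionStateIdentities.lean`, p72294).
-/

noncomputable section

open MeasureTheory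
open scoped ENNReal NNReal ComplexConjugate

namespace Summit.AtomisticToContinuum.BoseEinsteinCondensation.Theorems.CorrectorClosure.LlpFidelityArc

open Literature.MathematicalPhysics.QuantumManyBody.BoseGas

/-- **Registered stub (c,d) of line `llp-fidelity-arc` — insertion-state identities.** For a
repulsive finite-range `v`, `N` bath particles and a torus of side `L > 0`: (c) the insertion state
`φ₀ ⊗ Θ` has decoupled energy `coupledEnergy v 0 (insertionState hL Θ) = periodicEnergy v Θ`, and
(d) its squared overlap with an `(N+1)`-body state `Ψ` is the insertion residue of the crux target,
`|⟨φ₀ ⊗ Θ, Ψ⟩|² = L⁻³ |∫_{cell^N} conj Θ(X) ∫_cell Ψ(x, X) dx dX|²`. [folklore] -/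
theorem stub_insertionStateIdentities :
    ∀ (v : ℝ → ℝ≥0∞), IsRepulsiveFiniteRange v → ∀ (N : ℕ) (L : ℝ) (hL : 0 < L),
      (∀ Θ : PeriodicTrialState N L, coupledEnergy v 0 (insertionState hL Θ) = periodicEnergy v Θ) ∧
      (∀ (Θ : PeriodicTrialState N L) (Ψ : PeriodicTrialState (N + 1) L),
        ((‖taggedInner (insertionState hL Θ) Ψ.toTagged‖₊ : ℝ≥0∞) ^ 2) =
          ENNReal.ofReal ((L ^ 3)⁻¹) *
            (‖∫ X in cellN N L, conj (Θ.ψ X) *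
                ∫ x in cell L, Ψ.ψ (Matrix.vecCons x X)‖₊ : ℝ≥0∞) ^ 2) :=
  fun _ hv _ _ hL =>
    ⟨fun Θ => coupledEnergy_zero_insertionState hv.1 hL Θ,
      fun Θ Ψ => nnnorm_taggedInner_insertionState_sq hL Θ Ψ⟩

end Summit.AtomisticToContinuum.BoseEinsteinCondensation.Theorems.CorrectorClosure.LlpFidelityArc

end
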